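/-
Copyright (c) 2026 the pub-hodgecm-mathlib formalisation cell (harness21).  Prover seat hodgecm-mathlib-K2E3-p03 (g10) on the S4 valve (dealer K2E2-plan (g8), S4-R68: (TJ6) FILE 3b):
road (J̃♭) — THE HERBRAND WINDOW LETTER `h♮` OF ★ (TJ5-abs) FROM THE PURE INDEX IDENTITY AND THE PIN (measure half of (TJ6)).
Crux H413 `stmt-HodgeConjecture-24833`, lane `--supports … --as helper` (count-neutral).  THEOREMS ONLY (no `def`, no `instance`, no notation, no named-fact hypothesis, no `sorry`).
-/
import Literature.MeasureTheory.Group.SubgroupRelIndexMeasure     -- ★ `measure_subgroup_eq_relIndex_mul_of_isCompact` (Haar mass of a compact open subgroup = relative index × mass of an open subgroup)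
import Mathlib.Topology.Algebra.Group.Basic
import HarnessLib

/-!
# R90-TF · S4 (Ch. 13.1–2) · road (J̃♭) «TWISTED TUBE JACOBIAN», (TJ6) FILE 3b: the Herbrand window letter from the index identity and the pin

Dealt by the S4 dealer K2E2-plan (g8) (S4-R68 03:16Z; (TJ6) census of record R90-C131-p02 (g2) `CENSUS-TJ6.md` 27012a94 §1 (a)–(d), §3 (P)).  In the frame of ★ (TJ5-abs)
`R90S4TwistedTubeJacobianCore.twistedTubeJacobian_of_local` (p864907) — `ε : G →* G`, `A ≤ G` (`T̃`), `P′ ≤ G` (`T′ = A^ε`), `φ : ↥A →* P` (the norm `N`), windows `W j ≤ A` — its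
fourth letter is the HERBRAND WINDOW identity
  `h♮ : ρ(c(W_j)) · τ′(P′ ∩ W_j) = ρ(ker φ ∩ W_j) · tP(φ(W_j))`,   `c(w) = w ε(w)⁻¹`,
a CROSS identity between a Haar measure `ρ` of `ker φ = T̃ᴺ`, a Haar measure `τ′` of `P′ = T′` and the pinned `tP = e^* τ′` on `P = T` (p02 §1 (d): only the cross form is true at dyadic places).
THIS FILE reduces it to PURE GROUP THEORY: with the four window subgroups `K_W = ker φ ∩ W`, `cW = c(W) ≤ K_W` (in `ker φ`) and `F_W = P′ ∩ W`, `NW = N(W) ≤ F_W` (in `P′`) entering as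
binders with membership letters, the index identity **`hidx : [K_W : cW] = [F_W : NW]`** (p02 §1 (a); = `|Ĥ⁻¹(⟨ε⟩, W)| = |Ĥ⁰(⟨ε⟩, W)|`, the Herbrand quotient `h(⟨ε⟩, W) = 1`, FILE 3a's output from
FILE 1 `R90S4HerbrandWindowIndex` + FILE 2 `R90S4CayleyWindowDoubling`) and THE PIN `e : P ≃* ↥P′`, `e(φ w) = w ε(w)`, `tP.map e = τ′` give `h♮` VERBATIM:
`ρ(K_W) = [K_W : cW] ρ(cW)` and `τ′(F_W) = [F_W : NW] τ′(NW)` (★ `measure_subgroup_eq_relIndex_mul_of_isCompact`, the windows being compact open and `cW`, `NW` open), and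
`tP(φ(W)) = (tP.map e)(NW) = τ′(NW)` (`φ(W) = e⁻¹(NW)` by the pin and injectivity of `e`).  No Haar-ness, no second countability: any left-invariant Borel `ρ`, `τ′`.
HONEST LABEL: HC_CM is proved only modulo the 7 printed citations (2 remaining named inputs: hLiu418 = `stmt-HodgeConjecture-24832`, h413 = `stmt-HodgeConjecture-24833`)
until rung 0 closes; (J̃♭)∕(TJ6) OPEN — this pays `h♮` MODULO `hidx` (FILE 3a, R90-C131-p02 (g2)) and the pin (p31 (g3)); REL ≠ ★ ≠ BUILT.

## References
* [Rogawski1990] J. Rogawski, *Automorphic Representations of Unitary Groups in Three Variables* (1990), §3.11 Prop. 3.11.1 pp. 34–35 (`T̃ᴺ`, `N`, `H¹`), §12.5 p. 186.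
* [Serre1979] J.-P. Serre, *Local Fields*, GTM 67 (1979), Ch. VIII §4 (Herbrand quotient of a cyclic group acting on a module; `h = |Ĥ⁰|∕|Ĥ¹|`).
* [DeitmarEchterhoff2014] A. Deitmar, S. Echterhoff, *Principles of Harmonic Analysis*, 2nd ed. (2014), §1.5 (Haar measure and finite-index subgroups).
-/

set_option autoImplicit false
-- the mandated namespace repeats the single-problem summit's segment (`HodgeConjecture.HodgeConjecture`)
set_option linter.dupNamespace false

noncomputable section

open MeasureTheory MeasureTheory.Measure Set Filter Topology Function
open scoped ENNReal NNReal Pointwise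
open Literature.MeasureTheory.Group

namespace Summit.HodgeConjecture.HodgeConjecture.R90.S4

section HerbrandWindowMeasure

variable {G : Type*} [Group G] (ε : G →* G) (A P' : Subgroup G) {P : Type*} [Group P] (φ : ↥A →* P)

/-! ## §1 The four window sets of `h♮` as the four window subgroups -/

/-- The coboundary window of `h♮`: `val⁻¹(c(W)) = ↑cW` in `ker φ`, for `cW` given by its membership letter. [cite: Rogawski1990, §3.11 p. 34] -/
theorem preimage_coboundary_image_eq_coe (hεA : ∀ x ∈ A, ε x ∈ A) (Wj : Subgroup ↥A) (cWj : Subgroup ↥φ.ker)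
    (hcW : ∀ k : ↥φ.ker, k ∈ cWj ↔ ∃ w ∈ Wj, (((k : ↥A)) : G) = (w : G) * (ε w)⁻¹) :
    (Subtype.val : ↥φ.ker → ↥A) ⁻¹' ((fun w : ↥A => w * (⟨ε w, hεA w w.2⟩ : ↥A)⁻¹) '' (Wj : Set ↥A)) = (cWj : Set ↥φ.ker) := by
  ext k
  simp only [mem_preimage, mem_image, SetLike.mem_coe, hcW]
  constructor
  · rintro ⟨w, hw, hwk⟩
    refine ⟨w, hw, ?_⟩
    rw [← hwk, Subgroup.coe_mul, Subgroup.coe_inv]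
  · rintro ⟨w, hw, hk⟩
    refine ⟨w, hw, Subtype.ext ?_⟩
    rw [Subgroup.coe_mul, Subgroup.coe_inv, hk]

/-- The norm-one window of `h♮`: `val⁻¹(W) = ↑K_W` in `ker φ`. [cite: Rogawski1990, §3.11 p. 34] -/
theorem preimage_window_eq_coe (Wj : Subgroup ↥A) (KWj : Subgroup ↥φ.ker) (hKW : ∀ k : ↥φ.ker, k ∈ KWj ↔ (k : ↥A) ∈ Wj) :
    (Subtype.val : ↥φ.ker → ↥A) ⁻¹' (Wj : Set ↥A) = (KWj : Set ↥φ.ker) := by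
  ext k
  simp only [mem_preimage, SetLike.mem_coe, hKW]

/-- The fixed window of `h♮`: `val⁻¹(val(W)) = ↑F_W` in `P′`. [cite: Rogawski1990, §3.11 p. 34] -/
theorem preimage_image_window_eq_coe (Wj : Subgroup ↥A) (FWj : Subgroup ↥P') (hFW : ∀ p : ↥P', p ∈ FWj ↔ (p : G) ∈ Subtype.val '' (Wj : Set ↥A)) :
    (Subtype.val : ↥P' → G) ⁻¹' (Subtype.val '' (Wj : Set ↥A)) = (FWj : Set ↥P') := by
  ext p
  simp only [mem_preimage, SetLike.mem_coe, hFW]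

/-- **The norm window through the pin**: `φ(W) = e⁻¹(NW)` for the pin `e : P ≃* ↥P′` with `e(φ w) = w·ε(w)` (injectivity of `e`). [cite: Rogawski1990, §3.11 Prop. 3.11.1 p. 34] -/
theorem image_window_eq_preimage_pin (Wj : Subgroup ↥A) (NWj : Subgroup ↥P') (hNW : ∀ p : ↥P', p ∈ NWj ↔ ∃ w ∈ Wj, (p : G) = (w : G) * ε w)
    (e : P ≃* ↥P') (hφe : ∀ w : ↥A, ((e (φ w) : ↥P') : G) = (w : G) * ε w) :
    φ '' (Wj : Set ↥A) = e ⁻¹' (NWj : Set ↥P') := by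
  ext p
  simp only [mem_image, mem_preimage, SetLike.mem_coe, hNW]
  constructor
  · rintro ⟨w, hw, rfl⟩
    exact ⟨w, hw, hφe w⟩
  · rintro ⟨w, hw, hp⟩
    refine ⟨w, hw, e.injective (Subtype.ext ?_)⟩
    rw [hφe, ← hp]

/-- `cW ≤ K_W`: a coboundary `w ε(w)⁻¹` of `w ∈ W` lies in `W` when `W` is an `ε`-stable subgroup. [cite: Rogawski1990, §3.11 p. 34] -/
theorem coboundaryWindow_le (hεA : ∀ x ∈ A, ε x ∈ A) (Wj : Subgroup ↥A) (hWε : ∀ w : ↥A, w ∈ Wj → (⟨ε w, hεA w w.2⟩ : ↥A) ∈ Wj)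
    (KWj cWj : Subgroup ↥φ.ker) (hKW : ∀ k : ↥φ.ker, k ∈ KWj ↔ (k : ↥A) ∈ Wj)
    (hcW : ∀ k : ↥φ.ker, k ∈ cWj ↔ ∃ w ∈ Wj, (((k : ↥A)) : G) = (w : G) * (ε w)⁻¹) : cWj ≤ KWj := by
  intro k hk
  obtain ⟨w, hw, hkw⟩ := (hcW k).1 hk
  rw [hKW]
  have hk' : (k : ↥A) = w * (⟨ε w, hεA w w.2⟩ : ↥A)⁻¹ := Subtype.ext (by rw [hkw, Subgroup.coe_mul, Subgroup.coe_inv])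
  rw [hk']
  exact Wj.mul_mem hw (Wj.inv_mem (hWε w hw))

/-- `NW ≤ F_W`: a norm `w ε(w)` of `w ∈ W` lies in `W` when `W` is an `ε`-stable subgroup. [cite: Rogawski1990, §3.11 p. 34] -/
theorem normWindow_le (hεA : ∀ x ∈ A, ε x ∈ A) (Wj : Subgroup ↥A) (hWε : ∀ w : ↥A, w ∈ Wj → (⟨ε w, hεA w w.2⟩ : ↥A) ∈ Wj)
    (FWj NWj : Subgroup ↥P') (hFW : ∀ p : ↥P', p ∈ FWj ↔ (p : G) ∈ Subtype.val '' (Wj : Set ↥A))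
    (hNW : ∀ p : ↥P', p ∈ NWj ↔ ∃ w ∈ Wj, (p : G) = (w : G) * ε w) : NWj ≤ FWj := by
  intro p hp
  obtain ⟨w, hw, hpw⟩ := (hNW p).1 hp
  rw [hFW]
  exact ⟨w * ⟨ε w, hεA w w.2⟩, Wj.mul_mem hw (hWε w hw), by rw [hpw, Subgroup.coe_mul]⟩

/-! ## §2 `h♮` from the index identity and the pin -/

variable [TopologicalSpace G] [IsTopologicalGroup G] [MeasurableSpace G] [BorelSpace G] [TopologicalSpace P] [MeasurableSpace P] [BorelSpace P]

/-- **THE HERBRAND WINDOW LETTER FROM THE INDEX IDENTITY AND THE PIN** (`herbrandWindow_of_index`, (TJ6) FILE 3b).  In the (TJ5-abs) frame with compact open `ε`-stable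
windows `W j ≤ A`, let the four window subgroups `K_W = ker φ ∩ W`, `cW = c(W)` (in `ker φ`), `F_W = P′ ∩ W`, `NW = N(W)` (in `P′`) be given by membership letters, with `cW`, `NW`
open for `j ≥ j₀`, and let `e : P ≃* ↥P′` be the pin (`e` continuous, `e(φ w) = w ε(w)`, `tP.map e = τ′`).  If **`[K_W : cW] = [F_W : NW]`** for `j ≥ j₀` (`hidx`, the Herbrand
quotient `h(⟨ε⟩, W_j) = 1`), then for every left-invariant `ρ` on `ker φ` and `τ′` on `P′` the `h♮` letter of ★ `twistedTubeJacobian_of_local` holds VERBATIM: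
**`ρ(c(W_j)) · τ′(P′ ∩ W_j) = ρ(ker φ ∩ W_j) · tP(φ(W_j))`** — `ρ(K_W) = [K_W:cW] ρ(cW)`, `τ′(F_W) = [F_W:NW] τ′(NW)` (★ `measure_subgroup_eq_relIndex_mul_of_isCompact`),
`tP(φ W) = τ′(NW)` (pin). [cite: Serre1979, Ch. VIII §4] [cite: Rogawski1990, §3.11 Prop. 3.11.1 pp. 34–35] [cite: DeitmarEchterhoff2014, §1.5] -/
theorem herbrandWindow_of_index [T1Space P] [hP' : IsClosed (P' : Set G)] (hP'A : P' ≤ A) (hεA : ∀ x ∈ A, ε x ∈ A) (hφc : Continuous φ)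
    (ρ : Measure ↥φ.ker) [ρ.IsMulLeftInvariant] (τ' : Measure ↥P') [τ'.IsMulLeftInvariant] (tP : Measure P)
    (W : ℕ → Subgroup ↥A) (hWo : ∀ j, IsOpen (W j : Set ↥A)) (hWc : ∀ j, IsCompact (W j : Set ↥A))
    (hWε : ∀ (j : ℕ) (w : ↥A), w ∈ W j → (⟨ε w, hεA w w.2⟩ : ↥A) ∈ W j) {j₀ : ℕ}
    (KW cW : ℕ → Subgroup ↥φ.ker) (FW NW : ℕ → Subgroup ↥P')
    (hKW : ∀ (j : ℕ) (k : ↥φ.ker), k ∈ KW j ↔ (k : ↥A) ∈ W j)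
    (hcW : ∀ (j : ℕ) (k : ↥φ.ker), k ∈ cW j ↔ ∃ w ∈ W j, (((k : ↥A)) : G) = (w : G) * (ε w)⁻¹)
    (hFW : ∀ (j : ℕ) (p : ↥P'), p ∈ FW j ↔ (p : G) ∈ Subtype.val '' (W j : Set ↥A))
    (hNW : ∀ (j : ℕ) (p : ↥P'), p ∈ NW j ↔ ∃ w ∈ W j, (p : G) = (w : G) * ε w)
    (hcWo : ∀ j, j₀ ≤ j → IsOpen (cW j : Set ↥φ.ker)) (hNWo : ∀ j, j₀ ≤ j → IsOpen (NW j : Set ↥P'))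
    (hidx : ∀ j, j₀ ≤ j → (cW j).relIndex (KW j) = (NW j).relIndex (FW j))
    (e : P ≃* ↥P') (he : Continuous e) (hφe : ∀ w : ↥A, ((e (φ w) : ↥P') : G) = (w : G) * ε w) (hpin : tP.map e = τ') :
    ∀ j, j₀ ≤ j →
      ρ ((Subtype.val : ↥φ.ker → ↥A) ⁻¹' ((fun w : ↥A => w * (⟨ε w, hεA w w.2⟩ : ↥A)⁻¹) '' (W j : Set ↥A))) *
          τ' ((Subtype.val : ↥P' → G) ⁻¹' (Subtype.val '' (W j : Set ↥A))) =
        ρ ((Subtype.val : ↥φ.ker → ↥A) ⁻¹' (W j : Set ↥A)) * tP (φ '' (W j)) := by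
  intro j hj
  -- the four sets are the four subgroups
  rw [preimage_coboundary_image_eq_coe ε A φ hεA (W j) (cW j) (hcW j), preimage_image_window_eq_coe A P' (W j) (FW j) (hFW j),
    preimage_window_eq_coe A φ (W j) (KW j) (hKW j), image_window_eq_preimage_pin ε A P' φ (W j) (NW j) (hNW j) e hφe]
  -- the pin transports `tP(φ W) = τ′(NW)`
  have hNWm : MeasurableSet (NW j : Set ↥P') := (hNWo j hj).measurableSet
  have hpinW : tP (e ⁻¹' (NW j : Set ↥P')) = τ' (NW j) := by
    rw [← hpin, Measure.map_apply he.measurable hNWm]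
  rw [hpinW]
  -- compact open windows: `K_W` in `ker φ`, `F_W` in `P′`
  have hK : IsClosed ((φ.ker : Subgroup ↥A) : Set ↥A) := by
    have h : ((φ.ker : Subgroup ↥A) : Set ↥A) = φ ⁻¹' {1} := by
      ext a
      simp only [SetLike.mem_coe, MonoidHom.mem_ker, mem_preimage, mem_singleton_iff]
    rw [h]
    exact isClosed_singleton.preimage hφc
  have hKWeq : (KW j : Set ↥φ.ker) = (Subtype.val : ↥φ.ker → ↥A) ⁻¹' (W j : Set ↥A) := (preimage_window_eq_coe A φ (W j) (KW j) (hKW j)).symm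
  have hKWo : IsOpen (KW j : Set ↥φ.ker) := by rw [hKWeq]; exact (hWo j).preimage continuous_subtype_val
  have hKWc : IsCompact (KW j : Set ↥φ.ker) := by rw [hKWeq]; exact hK.isClosedEmbedding_subtypeVal.isCompact_preimage (hWc j)
  have hFWeq : (FW j : Set ↥P') = (fun p : ↥P' => (⟨(p : G), hP'A p.2⟩ : ↥A)) ⁻¹' (W j : Set ↥A) := by
    ext p
    simp only [SetLike.mem_coe, hFW, mem_preimage, mem_image]
    constructor
    · rintro ⟨w, hw, hwp⟩
      have : w = ⟨(p : G), hP'A p.2⟩ := Subtype.ext hwp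
      exact this ▸ hw
    · intro hp
      exact ⟨_, hp, rfl⟩
  have hFWo : IsOpen (FW j : Set ↥P') := by
    rw [hFWeq]
    exact (hWo j).preimage (continuous_subtype_val.subtype_mk _)
  have hFWc : IsCompact (FW j : Set ↥P') := by
    rw [← preimage_image_window_eq_coe A P' (W j) (FW j) (hFW j)]
    exact hP'.isClosedEmbedding_subtypeVal.isCompact_preimage ((hWc j).image continuous_subtype_val)
  -- Haar mass = index × mass on both sides
  obtain ⟨-, hρ⟩ := measure_subgroup_eq_relIndex_mul_of_isCompact ρ (coboundaryWindow_le ε A φ hεA (W j) (hWε j) (KW j) (cW j) (hKW j) (hcW j)) hKWc hKWo (hcWo j hj)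
  obtain ⟨-, hτ⟩ := measure_subgroup_eq_relIndex_mul_of_isCompact τ' (normWindow_le ε A P' hεA (W j) (hWε j) (FW j) (NW j) (hFW j) (hNW j)) hFWc hFWo (hNWo j hj)
  rw [hρ, hτ, hidx j hj]
  ring

end HerbrandWindowMeasure

end Summit.HodgeConjecture.HodgeConjecture.R90.S4

end
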